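import Mathlib
import HarnessLib.Audit
import Summits.PneNP.PneNP.Theorems.PstarGateNodesX
import Summits.PneNP.PneNP.Theorems.PstarGateFibreRank
import Summits.PneNP.PneNP.Theorems.PstarGateCasePPin

/-!
# One GATED chord, node N6′ (closed core): the single gated cycle with an AFFINE second constraint is the PIN + GATE triangle (E2; prover-1 g18)

FRONTIER range-avoidance ladder, rung F-N3 (`stmt-PneNP-19007`), cell `pnp-ideate` (`PstarGateNodesX.GateUnitCycleAffineX`; this seat's
`HOME/pnp-ideate-prover-1/g18/E2-PLAN.md` §2 B0); restricted-model proof complexity — nothing here bears on `P` versus `NP`.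

`N = {e}`: the gated chord is the only chord, so the core is the cycle `D e + e` (`J₀_eq_of_single`, XOR-closed core) and CASE P holds vacuously.
* `zpoint_of_single` — (M0) at `e` + (T3) give a base point `a` with `q(a) = 0` and `ℓ(a) ≠ 0` (`q = q_{(1,0)} = F₂ + t₂`, `ℓ = coef = κ₀ + x_u`):
  the M-state of `e` hits the target, its second coordinate is state-free, and if `ℓ(a) = 0` every admissible state hits the target too.
* `gateUnitCycleAffineX_holds : GateUnitCycleAffineX` — **PROVED**.  By (T3) (`caseP_forced`) `Q_{D e} ≡ γ_e + 1` on `Z(q) ∩ {ℓ ≠ 0} ⊇ Z(q) ∩ (a +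
  coordKer {u})`.  If `Q_{D e}` keeps rank `≥ 4` on the chamber `coordKer {u}`, `PstarForcing.not_forced_of_affine` ON THE CHAMBER (the affine `q`
  restricted, `PstarQuadRestrict.quad_restrict`) empties `Z(q)` there — contradicting `q(a) = 0`.  Otherwise `PstarGateFibreRank.card_eq_two_of_not_rank_four`:
  `#D e = 2`, so `#J₀ = 3`.  This covers every affine `q` (constant, one literal = `PstarGateCasePPin`, several literals): the multi-literal pins are EMPTY
  beyond the triangle.
-/

set_option linter.dupNamespace false -- `Summit.PneNP.PneNP.…`: summit = sub-problem name (D-0017 single-conjunct layout)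

open Finset Module Literature.Computability.Complexity
open Summit.PneNP.PneNP.Theorems.PstarTyped (Typed)
open Summit.PneNP.PneNP.Theorems.PstarSALevel (BoundaryExpanding SimpleOverlap)
open Summit.PneNP.PneNP.Theorems.PstarCoreBound (XorClosed)
open Summit.PneNP.PneNP.Theorems.PstarCubeIdeals (IsAffineFn)
open Summit.PneNP.PneNP.Theorems.PstarProductRank (qform polar)
open Summit.PneNP.PneNP.Theorems.PstarQuadRank (rad)
open Summit.PneNP.PneNP.Theorems.PstarForcing (not_forced_of_affine)
open Summit.PneNP.PneNP.Theorems.PstarQuadRestrict (quad_restrict)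
open Summit.PneNP.PneNP.Theorems.PstarPathRankFibre (coordKer mem_coordKer)
open Summit.PneNP.PneNP.Theorems.PstarReadSumset (V2)
open Summit.PneNP.PneNP.Theorems.PstarChordSystem (ChordSystem)
open Summit.PneNP.PneNP.Theorems.PstarChordBridgeTools (privs coef)
open Summit.PneNP.PneNP.Theorems.PstarChordBridge (BridgeData sys Solution Lift infeasible_of_not_solution chordMinimal_of_solution_erase)
open Summit.PneNP.PneNP.Theorems.PstarChordBridgeCotree (Peelable)
open Summit.PneNP.PneNP.Theorems.PstarChordBridgeForcing (gam qform_add' rank_four_of_wf)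
open Summit.PneNP.PneNP.Theorems.PstarChordBridgeBasis (qDir)
open Summit.PneNP.PneNP.Theorems.PstarNorUnitRegime (J₀_eq_of_single)
open Summit.PneNP.PneNP.Theorems.PstarGateBridge (GateHyp gate_reads caseP_forced)
open Summit.PneNP.PneNP.Theorems.PstarGateFibreRank (card_eq_two_of_not_rank_four)
open Summit.PneNP.PneNP.Theorems.PstarGateNodes (GateData)
open Summit.PneNP.PneNP.Theorems.PstarGateNodesX (GateDataX GateUnitCycleAffineX)

namespace Summit.PneNP.PneNP.Theorems.PstarGateUnitCycleAffine

variable {n m : ℕ}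

/-- `q_{(1,0)}` is the second coordinate of the state-free part plus the second target. -/
theorem qDir_one_zero (I : LocalMap 4 n m) (B : BridgeData n m) (x : Fin n → ZMod 2) :
    qDir I B (1, 0) x = ((sys I B).F x).2 + (sys I B).t.2 := by
  have h := PstarChordBridgeBasis.q_dir I B (1, 0) x
  rw [PstarChordSystemMap.mapSys_F, PstarChordSystemMap.mapSys_t, PstarChordSystemMap.toX_snd, PstarChordSystemMap.toX_snd] at h
  simp only [mul_zero, mul_one, zero_add] at h
  exact h.symm

/-- **(M0) at the gated chord, single-chord case**: a point of `Z(q)` where the gate coefficient is on. -/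
theorem zpoint_of_single (I : LocalMap 4 n m) (hI : I.IsPure xorAndPred) (hT : Typed I) {B : BridgeData n m} (hW : B.WF I) (hL : Lift I B)
    {e : Fin m} (hG : GateHyp I B e) (hN : B.N = {e}) (hT3 : ¬ ∃ z, Solution I B B.J₀ z) (hM0e : ∃ z, Solution I B (B.J₀.erase e) z) :
    ∃ a : Fin n → ZMod 2, qDir I B (1, 0) a = 0 ∧ coef I B.C₁ B.G₁ (I.vars e 2) a ≠ 0 := by
  classical
  have hinf : (sys I B).Infeasible B.N := infeasible_of_not_solution I hI hT hW hL hT3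
  obtain ⟨z, hz⟩ := hM0e
  obtain ⟨a, s, -, hval⟩ := chordMinimal_of_solution_erase I hI hT hW hG.1 hz
  have hvals : ∀ s' : Fin m → ZMod 2 × ZMod 2,
      (sys I B).val B.N a s' = (sys I B).F a + ((s' e).1 * coef I B.C₁ B.G₁ (I.vars e 2) a, 0) := by
    intro s'
    unfold ChordSystem.val
    rw [hN, sum_singleton]
    unfold ChordSystem.contrib
    rw [(gate_reads I hI hG a).1, (gate_reads I hI hG a).2, smul_zero, add_zero]
    rfl
  refine ⟨a, ?_, fun hc => ?_⟩
  · have h2 := congrArg Prod.snd hval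
    rw [hvals s, Prod.snd_add, add_zero] at h2
    rw [qDir_one_zero, h2, CharTwo.add_self_eq_zero]
  · have hFt : (sys I B).F a = (sys I B).t := by
      have h := hval
      rw [hvals s, hc, mul_zero] at h
      simpa using h
    refine hinf a (fun _ => (1, (sys I B).u e a)) (fun i hi => ?_) ?_
    · rw [hN, mem_singleton] at hi
      rw [hi, one_mul]
    rw [hvals, hc, mul_zero]
    simpa using hFt

/-- **N6′ on a closed core holds: the single gated cycle with affine `q` is the triangle.** -/
theorem gateUnitCycleAffineX_holds : GateUnitCycleAffineX := by
  intro n m r I hI hT hS hB B e g₀ u κ₀ hD hN haff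
  classical
  obtain ⟨hX, hW, hr, hd₁, -, hL, hPe, -, hG, hg₀, hgv, -, -, -, -, hcoef, hT3, hM0⟩ := id hD
  have he : e ∈ B.N := hG.1
  have hJr : B.J₀.card ≤ r := (card_le_card (subset_union_left.trans subset_union_left)).trans hr
  have hg₀J : g₀ ∉ B.J₀ := fun h => disjoint_left.1 hd₁ hg₀ h
  have heD : e ∉ B.D e := fun h => (mem_sdiff.1 (hW.hD e he h)).2 he
  -- CASE P vacuously
  have hothers : ∀ e' ∈ B.N, e' ≠ e → False := fun e' he' hne => hne (by rw [hN] at he'; exact mem_singleton.1 he')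
  have hP : ∀ e' ∈ B.N, e' ≠ e → ∀ a, ((sys I B).ρ e' a = 0 ∨ (sys I B).ρ e' a = (1, 0)) ∧ ((sys I B).ρ' e' a = 0 ∨ (sys I B).ρ' e' a = (1, 0)) :=
    fun e' he' hne => (hothers e' he' hne).elim
  have hread : ∀ e' ∈ B.N, e' ≠ e → ∀ a, (sys I B).ρ e' a ≠ 0 ∨ (sys I B).ρ' e' a ≠ 0 := fun e' he' hne => (hothers e' he' hne).elim
  -- (T3): `Q_{D e} = γ + 1` on `Z(q) ∩ {ℓ ≠ 0}`
  have hforced : ∀ x, qDir I B (1, 0) x = 0 → coef I B.C₁ B.G₁ (I.vars e 2) x ≠ 0 →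
      qform (B.D e) (fun j => I.vars j 2) (fun j => I.vars j 3) x = gam B e + 1 :=
    fun x hq hc => (caseP_forced I hI hT hW hL hG hT3 hP hread hq).2 hc
  -- (M0): a point of `Z(q)` in the chamber where the gate reads
  obtain ⟨a, hqa, hca⟩ := zpoint_of_single I hI hT hW hL hG hN hT3 (hM0 e (hW.hN he))
  have hJ := J₀_eq_of_single I hI hT hW hX hPe hN
  by_cases hrank : finrank (ZMod 2) (rad ((polar (B.D e) (fun j => I.vars j 2) (fun j => I.vars j 3)).restrict (coordKer ({u} : Finset (Fin n)))))
      + 4 ≤ finrank (ZMod 2) (coordKer ({u} : Finset (Fin n)))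
  · -- rank ≥ 4 on the chamber: the affine `q` cannot force `Q_{D e}` there
    exfalso
    set W := coordKer ({u} : Finset (Fin n)) with hWdef
    have hcoefW : ∀ w : W, coef I B.C₁ B.G₁ (I.vars e 2) (a + (w : Fin n → ZMod 2)) = coef I B.C₁ B.G₁ (I.vars e 2) a := by
      intro w
      rw [hcoef, hcoef, Pi.add_apply, (mem_coordKer.1 w.2) u (mem_singleton_self u), add_zero]
    have hZ : ∀ w : W, (fun w : W => qDir I B (1, 0) (a + (w : Fin n → ZMod 2))) w = 0 →
        (fun w : W => qform (B.D e) (fun j => I.vars j 2) (fun j => I.vars j 3) (a + (w : Fin n → ZMod 2))) w = gam B e + 1 :=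
      fun w hw => hforced _ hw (by rw [hcoefW]; exact hca)
    have hqW : IsAffineFn (fun w : W => qDir I B (1, 0) (a + (w : Fin n → ZMod 2))) := by
      intro v w
      simp only [Submodule.coe_add, Submodule.coe_zero, add_zero]
      rw [haff a (v + w), haff (v : Fin n → ZMod 2) w, haff a v, haff a w]
      generalize qDir I B (1, 0) a = qa
      generalize qDir I B (1, 0) (v : Fin n → ZMod 2) = qv
      generalize qDir I B (1, 0) (w : Fin n → ZMod 2) = qw
      generalize qDir I B (1, 0) 0 = q0
      revert qa qv qw q0; decide
    have hQW := quad_restrict (qform_add' I (B.D e)) W a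
    have hall := not_forced_of_affine (M := W) (Q := fun w : W => qform (B.D e) (fun j => I.vars j 2) (fun j => I.vars j 3) (a + (w : Fin n → ZMod 2)))
      hqW (fun v w => by simpa using hQW v w) hrank hZ
    have h0 := hall 0
    simp only [Submodule.coe_zero, add_zero] at h0
    rw [hqa] at h0
    exact zero_ne_one h0
  · -- rank deficiency on the chamber: the triangle
    have hrX : (insert g₀ (insert e (B.D e))).card ≤ r := by
      refine le_trans (card_le_card ?_) hr
      refine insert_subset (mem_union_left _ (mem_union_right _ hg₀)) ?_
      exact (insert_subset (hW.hN he) ((hW.hD e he).trans sdiff_subset)).trans (subset_union_left.trans subset_union_left)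
    obtain ⟨h2, -⟩ := card_eq_two_of_not_rank_four I hI hS hB hW hJr he hg₀J hgv hrX hrank
    rw [hJ, card_insert_of_notMem heD, h2]
    norm_num

end Summit.PneNP.PneNP.Theorems.PstarGateUnitCycleAffine
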